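import Mathlib
import Summits.MatrixMultiplication.MatrixMultiplication.Theorems.LieRankDesigns.Negative.Basics
import Summits.MatrixMultiplication.MatrixMultiplication.Theorems.LevelGradedCohnUmansLieRankDesignsStubFrameFnLevel
import Summits.MatrixMultiplication.MatrixMultiplication.Theorems.LevelOneGL2Designs.Negative.LevelSpace

/-!
# `LieRankDesigns` (stmt-MatrixMultiplication-7614), line `fixed-rank-universality-gl2-level-one`: stub B `stub_oracleSound` — soundness of the exact level-one oracle

Crux `Summit.MatrixMultiplication.MatrixMultiplication.Theses.LevelGradedCohnUmans.LieRankDesigns`; skeleton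
`Cruxes/LieRankDesigns/Lines/fixed_rank_universality_gl2_level_one.lean` (lead
prover-line-stmt-MatrixMultiplication-7614-c1-0, registered stubs A–D); this file proves the registered stub
`stub_oracleSound` verbatim (name + signature) and lands `--supports stmt-MatrixMultiplication-7614`.

Content (the level-one dictionary).  `G = GL_m(𝔽_p)`, `J = F_1|_G = levelSubmodule p m 1` (functions
`g ↦ Σ_M c_M ψ(tr(M g))` with `c` supported on `rk M ≤ 1`, the sibling crux's landed `LevelSpace`).  Every
matrix entry of the permutation representation on column vectors, `g ↦ [g u = v]`, lies in `J`: it is the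
`1`-frame function of the indicator kernel `φ U W = [U = col u ∧ W = col v]` on `m × 1` matrices (landed
stub K `stub_frameFnLevel` at `k = 1`; `entry_mem_levelSubmodule`).  Hence there is a linear map
`T : J^* → ℂ^{𝔽_p^m × 𝔽_p^m}`, `ξ ↦ (ξ([· u = v]))_{v,u}`, sending the evaluation functional `ev_g|_J` to
the permutation matrix `π(g) = ([g u = v])_{v,u}` (`exists_dict`).  So linear independence of the matrices
`π(t i)` gives linear independence of the functionals `ev_{t i}|_J` (`linearIndependent_ev`,
`LinearIndependent.of_comp`), and disjointness of `span π(t i)` from `span π(S)` gives the same upstairs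
(`disjoint_ev`; `T` is injective on the first span by `Submodule.range_ker_disjoint`).  With targets
`t (x,z) = x⁻¹z` and garbage `S = {x⁻¹yy'⁻¹z : y ≠ y'}` the abstract evaluation criterion (stub A, the
hypothesis, verbatim) cuts out each `x₀⁻¹z₀` by some `f = fourierFn c ∈ J` (`RankSupp 1 c`), and
`rankSep_of_cutout` reads off the `RankSep 1` clause (`y = y'` collapses `x⁻¹yy'⁻¹z` to `x⁻¹z`).
-/

set_option linter.dupNamespace false

noncomputable section

open scoped BigOperators
open Literature.RepresentationTheory.FiniteGroups
open Summit.MatrixMultiplication.MatrixMultiplication.Theorems.LieRankDesigns.Negative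
  (GLm Mat fourierFn RankSupp RankSep levelSet budget volume)
open Summit.MatrixMultiplication.MatrixMultiplication.Theorems.LevelOneGL2Designs.Negative
  (levelSubmodule mem_levelSubmodule_iff)

namespace Summit.MatrixMultiplication.MatrixMultiplication.Theorems.LieRankDesigns

namespace OracleSound

variable {p m : ℕ} [Fact p.Prime]

/-- **Every entry function is a level-one test function**: `[g u = v] = Σ_U φ U (g U)` over the `m × 1`
matrices `U`, with `φ U W = [U = col u ∧ W = col v]`, a `1`-frame function (stub K at `k = 1`). -/
theorem entry_mem_levelSubmodule (u v : Fin m → ZMod p) :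
    (fun g : GLm p m => if (g : Mat p m).mulVec u = v then (1 : ℂ) else 0) ∈ levelSubmodule p m 1 := by
  classical
  set cu : Matrix (Fin m) (Fin 1) (ZMod p) := Matrix.replicateCol (Fin 1) u with hcu
  set cv : Matrix (Fin m) (Fin 1) (ZMod p) := Matrix.replicateCol (Fin 1) v with hcv
  have h : (fun g : GLm p m => ∑ U : Matrix (Fin m) (Fin 1) (ZMod p),
      (if U = cu ∧ (g : Mat p m) * U = cv then (1 : ℂ) else 0)) ∈ levelSet p m 1 :=
    stub_frameFnLevel p m 1 (fun U W => if U = cu ∧ W = cv then (1 : ℂ) else 0)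
  have heq : (fun g : GLm p m => ∑ U : Matrix (Fin m) (Fin 1) (ZMod p),
      (if U = cu ∧ (g : Mat p m) * U = cv then (1 : ℂ) else 0)) =
      fun g : GLm p m => if (g : Mat p m).mulVec u = v then (1 : ℂ) else 0 := by
    funext g
    rw [Finset.sum_eq_single cu]
    · by_cases hg : (g : Mat p m).mulVec u = v
      · rw [if_pos hg, if_pos]
        exact ⟨rfl, by rw [hcu, hcv, ← Matrix.replicateCol_mulVec, hg]⟩
      · rw [if_neg hg, if_neg]
        rintro ⟨-, hmul⟩
        apply hg
        rw [hcu, hcv, ← Matrix.replicateCol_mulVec] at hmul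
        exact Matrix.replicateCol_injective hmul
    · intro U _ hU
      rw [if_neg (fun hh => hU hh.1)]
    · intro hh
      exact absurd (Finset.mem_univ _) hh
  rw [heq] at h
  exact mem_levelSubmodule_iff.mpr h

/-- **The dictionary** `T : J^* → ℂ^{𝔽_p^m × 𝔽_p^m}`, `ξ ↦ (ξ([· u = v]))_{v,u}` (`J = F_1|_G`): a linear
map sending the evaluation functional `ev_g|_J` to the permutation matrix `π(g) = ([g u = v])_{v,u}`. -/
theorem exists_dict (p m : ℕ) [Fact p.Prime] :
    ∃ T : Module.Dual ℂ (levelSubmodule p m 1) →ₗ[ℂ] ((Fin m → ZMod p) → (Fin m → ZMod p) → ℂ),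
      ∀ g : GLm p m,
        T ((LinearMap.proj g).comp (levelSubmodule p m 1).subtype) =
          fun v u : Fin m → ZMod p => if (g : Mat p m).mulVec u = v then (1 : ℂ) else 0 :=
  ⟨LinearMap.pi fun v => LinearMap.pi fun u =>
      LinearMap.applyₗ (⟨fun g : GLm p m => if (g : Mat p m).mulVec u = v then (1 : ℂ) else 0,
        entry_mem_levelSubmodule u v⟩ : levelSubmodule p m 1),
    fun _ => rfl⟩

/-- **Oracle (a) lifts**: linear independence of the permutation matrices `π(t i)` gives linear
independence of the evaluation functionals `ev_{t i}|_J` (`LinearIndependent.of_comp T`). -/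
theorem linearIndependent_ev {ι : Type} (t : ι → GLm p m)
    (hind : LinearIndependent ℂ (fun i => fun v u : Fin m → ZMod p =>
      if ((t i : GLm p m) : Mat p m).mulVec u = v then (1 : ℂ) else 0)) :
    LinearIndependent ℂ (fun i =>
      ((LinearMap.proj (t i)).comp (levelSubmodule p m 1).subtype :
        Module.Dual ℂ (levelSubmodule p m 1))) := by
  obtain ⟨T, hT⟩ := exists_dict p m
  apply LinearIndependent.of_comp T
  have hcomp : (⇑T ∘ fun i => ((LinearMap.proj (t i)).comp (levelSubmodule p m 1).subtype :
      Module.Dual ℂ (levelSubmodule p m 1))) =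
      fun i => fun v u : Fin m → ZMod p =>
        if ((t i : GLm p m) : Mat p m).mulVec u = v then (1 : ℂ) else 0 :=
    funext fun i => hT (t i)
  rw [hcomp]
  exact hind

/-- **Oracle (b) lifts**: if moreover `span π(t i)` meets `span π(S)` trivially, then `span ev_{t i}|_J`
meets `span ev_S|_J` trivially — the dictionary `T` maps the two spans into the two matrix spans and is
injective on the first (`Submodule.range_ker_disjoint`). -/
theorem disjoint_ev {ι : Type} (t : ι → GLm p m) (S : Set (GLm p m))
    (hind : LinearIndependent ℂ (fun i => fun v u : Fin m → ZMod p =>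
      if ((t i : GLm p m) : Mat p m).mulVec u = v then (1 : ℂ) else 0))
    (hdisj : Disjoint
      (Submodule.span ℂ (Set.range fun i => fun v u : Fin m → ZMod p =>
        if ((t i : GLm p m) : Mat p m).mulVec u = v then (1 : ℂ) else 0))
      (Submodule.span ℂ ((fun g : GLm p m => fun v u : Fin m → ZMod p =>
        if (g : Mat p m).mulVec u = v then (1 : ℂ) else 0) '' S))) :
    Disjoint
      (Submodule.span ℂ (Set.range fun i =>
        ((LinearMap.proj (t i)).comp (levelSubmodule p m 1).subtype :
          Module.Dual ℂ (levelSubmodule p m 1))))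
      (Submodule.span ℂ ((fun g =>
        ((LinearMap.proj g).comp (levelSubmodule p m 1).subtype :
          Module.Dual ℂ (levelSubmodule p m 1))) '' S)) := by
  obtain ⟨T, hT⟩ := exists_dict p m
  have hcomp : (⇑T ∘ fun i => ((LinearMap.proj (t i)).comp (levelSubmodule p m 1).subtype :
      Module.Dual ℂ (levelSubmodule p m 1))) =
      fun i => fun v u : Fin m → ZMod p =>
        if ((t i : GLm p m) : Mat p m).mulVec u = v then (1 : ℂ) else 0 :=
    funext fun i => hT (t i)
  have hcompS : (⇑T ∘ fun g => ((LinearMap.proj g).comp (levelSubmodule p m 1).subtype :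
      Module.Dual ℂ (levelSubmodule p m 1))) =
      fun g : GLm p m => fun v u : Fin m → ZMod p =>
        if (g : Mat p m).mulVec u = v then (1 : ℂ) else 0 :=
    funext fun g => hT g
  have hker : Disjoint
      (Submodule.span ℂ (Set.range fun i =>
        ((LinearMap.proj (t i)).comp (levelSubmodule p m 1).subtype :
          Module.Dual ℂ (levelSubmodule p m 1))))
      (LinearMap.ker T) :=
    Submodule.range_ker_disjoint (by rw [hcomp]; exact hind)
  rw [Submodule.disjoint_def]
  intro w hwP hwQ
  have h1 : T w ∈ Submodule.span ℂ (Set.range fun i => fun v u : Fin m → ZMod p =>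
      if ((t i : GLm p m) : Mat p m).mulVec u = v then (1 : ℂ) else 0) := by
    have h := Submodule.mem_map_of_mem (f := T) hwP
    rwa [Submodule.map_span, ← Set.range_comp, hcomp] at h
  have h2 : T w ∈ Submodule.span ℂ ((fun g : GLm p m => fun v u : Fin m → ZMod p =>
      if (g : Mat p m).mulVec u = v then (1 : ℂ) else 0) '' S) := by
    have h := Submodule.mem_map_of_mem (f := T) hwQ
    rwa [Submodule.map_span, ← Set.image_comp, hcompS] at h
  have h0 : T w = 0 := Submodule.disjoint_def.mp hdisj _ h1 h2
  exact Submodule.disjoint_def.mp hker w hwP (LinearMap.mem_ker.mpr h0)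

/-- **From the cut-out functions to `RankSep 1`**: if every pair product `x₀⁻¹z₀` (`(x₀, z₀) ∈ X × Z`) is
cut out inside `F_1|_G` against the other pair products and all middle products `x⁻¹yy'⁻¹z`, `y ≠ y'`,
then `(X, Y, Z)` is rank-`≤ 1` separated (`y = y'` collapses the quadruple product to `x⁻¹z`). -/
theorem rankSep_of_cutout (X Y Z : Finset (GLm p m))
    (hcut : ∀ i : {q : GLm p m × GLm p m // q.1 ∈ X ∧ q.2 ∈ Z}, ∃ f ∈ levelSubmodule p m 1,
      f (i.1.1⁻¹ * i.1.2) = 1 ∧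
      (∀ j : {q : GLm p m × GLm p m // q.1 ∈ X ∧ q.2 ∈ Z}, j ≠ i → f (j.1.1⁻¹ * j.1.2) = 0) ∧
      ∀ s ∈ {g : GLm p m | ∃ x ∈ X, ∃ y ∈ Y, ∃ y' ∈ Y, ∃ z ∈ Z, y ≠ y' ∧ g = x⁻¹ * y * y'⁻¹ * z},
        f s = 0) :
    RankSep 1 X Y Z := by
  intro x₀ hx₀ z₀ hz₀
  obtain ⟨f, hfJ, hf1, hf0, hfS⟩ := hcut ⟨(x₀, z₀), hx₀, hz₀⟩
  obtain ⟨c, hc, hfc⟩ := mem_levelSubmodule_iff.mp hfJ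
  refine ⟨c, hc, fun x hx y hy y' hy' z hz => ?_⟩
  rw [← hfc]
  by_cases hyy : y = y'
  · subst hyy
    rw [mul_inv_cancel_right]
    by_cases hq : x = x₀ ∧ z = z₀
    · obtain ⟨rfl, rfl⟩ := hq
      rw [if_pos ⟨rfl, rfl, rfl⟩]
      exact hf1
    · rw [if_neg (fun hh => hq ⟨hh.1, hh.2.2⟩)]
      have hne : (⟨(x, z), hx, hz⟩ : {q : GLm p m × GLm p m // q.1 ∈ X ∧ q.2 ∈ Z}) ≠
          ⟨(x₀, z₀), hx₀, hz₀⟩ := by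
        intro hh
        apply hq
        simp only [Subtype.mk.injEq, Prod.mk.injEq] at hh
        exact hh
      exact hf0 ⟨(x, z), hx, hz⟩ hne
  · rw [if_neg (fun hh => hyy hh.2.1)]
    exact hfS _ ⟨x, hx, y, hy, y', hy', z, hz, hyy, rfl⟩

end OracleSound

open OracleSound in
/-- **Stub B `OracleSound`** (registered signature: stub A `EvalCriterion` ⇒ soundness of the level-one
oracle).  For `X, Y, Z ⊆ GL_m(𝔽_p)`: if the permutation matrices `π(x⁻¹z)` (indexed by `(x,z) ∈ X × Z`)
are linearly independent and their span is disjoint from the span of the `π(x⁻¹yy'⁻¹z)`, `y ≠ y'`, then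
`RankSep 1 X Y Z`.  Proof: the dictionary `T : (F_1|_G)^* → matrices`, `ev_g ↦ π(g)` (every entry
`g ↦ [g u = v]` is level one, `entry_mem_levelSubmodule` via stub K), transports both oracle conditions to
the evaluation functionals (`linearIndependent_ev`, `disjoint_ev` — the middle matrices are the images of
the middle products); the hypothesis (stub A) with `G := GL_m(𝔽_p)`, `J := F_1|_G`, targets `x⁻¹z`,
garbage `x⁻¹yy'⁻¹z` (`y ≠ y'`) cuts out each target, and `rankSep_of_cutout` reads off `RankSep 1`. -/
theorem stub_oracleSound :
    (∀ (G : Type) [Fintype G] (J : Submodule ℂ (G → ℂ)) (ι : Type) (t : ι → G) (S : Set G),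
      LinearIndependent ℂ (fun i => ((LinearMap.proj (t i)).comp J.subtype : Module.Dual ℂ J)) →
      Disjoint (Submodule.span ℂ (Set.range fun i => ((LinearMap.proj (t i)).comp J.subtype : Module.Dual ℂ J)))
        (Submodule.span ℂ ((fun g => ((LinearMap.proj g).comp J.subtype : Module.Dual ℂ J)) '' S)) →
      ∀ i : ι, ∃ f ∈ J, f (t i) = 1 ∧ (∀ j : ι, j ≠ i → f (t j) = 0) ∧ ∀ s ∈ S, f s = 0) →
    ∀ (p m : ℕ) [Fact p.Prime] (X Y Z : Finset (GLm p m)),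
      LinearIndependent ℂ (fun q : {q : GLm p m × GLm p m // q.1 ∈ X ∧ q.2 ∈ Z} =>
        fun v u : Fin m → ZMod p =>
          if ((q.1.1⁻¹ * q.1.2 : GLm p m) : Mat p m).mulVec u = v then (1 : ℂ) else 0) →
      Disjoint
        (Submodule.span ℂ (Set.range fun q : {q : GLm p m × GLm p m // q.1 ∈ X ∧ q.2 ∈ Z} =>
          fun v u : Fin m → ZMod p =>
            if ((q.1.1⁻¹ * q.1.2 : GLm p m) : Mat p m).mulVec u = v then (1 : ℂ) else 0))
        (Submodule.span ℂ {A : Matrix (Fin m → ZMod p) (Fin m → ZMod p) ℂ |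
          ∃ x ∈ X, ∃ y ∈ Y, ∃ y' ∈ Y, ∃ z ∈ Z, y ≠ y' ∧
            A = fun v u : Fin m → ZMod p =>
              if ((x⁻¹ * y * y'⁻¹ * z : GLm p m) : Mat p m).mulVec u = v then (1 : ℂ) else 0}) →
      RankSep 1 X Y Z := by
  intro hA p m _ X Y Z hind hdisj
  -- targets `t (x,z) = x⁻¹z` over `X × Z`, garbage `S` = the middle products with `y ≠ y'`
  have hdisj' : Disjoint
      (Submodule.span ℂ (Set.range fun q : {q : GLm p m × GLm p m // q.1 ∈ X ∧ q.2 ∈ Z} =>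
        fun v u : Fin m → ZMod p =>
          if (((fun q : {q : GLm p m × GLm p m // q.1 ∈ X ∧ q.2 ∈ Z} => q.1.1⁻¹ * q.1.2) q : GLm p m) :
            Mat p m).mulVec u = v then (1 : ℂ) else 0))
      (Submodule.span ℂ ((fun g : GLm p m => fun v u : Fin m → ZMod p =>
        if (g : Mat p m).mulVec u = v then (1 : ℂ) else 0) ''
          {g : GLm p m | ∃ x ∈ X, ∃ y ∈ Y, ∃ y' ∈ Y, ∃ z ∈ Z, y ≠ y' ∧ g = x⁻¹ * y * y'⁻¹ * z})) := by
    refine hdisj.mono_right (Submodule.span_mono ?_)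
    rintro _ ⟨s, hs, rfl⟩
    obtain ⟨x, hx, y, hy, y', hy', z, hz, hne, rfl⟩ := hs
    exact ⟨x, hx, y, hy, y', hy', z, hz, hne, rfl⟩
  exact rankSep_of_cutout X Y Z
    (hA (GLm p m) (levelSubmodule p m 1) {q : GLm p m × GLm p m // q.1 ∈ X ∧ q.2 ∈ Z}
      (fun q => q.1.1⁻¹ * q.1.2)
      {g : GLm p m | ∃ x ∈ X, ∃ y ∈ Y, ∃ y' ∈ Y, ∃ z ∈ Z, y ≠ y' ∧ g = x⁻¹ * y * y'⁻¹ * z}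
      (linearIndependent_ev (fun q : {q : GLm p m × GLm p m // q.1 ∈ X ∧ q.2 ∈ Z} => q.1.1⁻¹ * q.1.2)
        hind)
      (disjoint_ev (fun q : {q : GLm p m × GLm p m // q.1 ∈ X ∧ q.2 ∈ Z} => q.1.1⁻¹ * q.1.2)
        _ hind hdisj'))

end Summit.MatrixMultiplication.MatrixMultiplication.Theorems.LieRankDesigns

end
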